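import Mathlib.Combinatorics.Colex
import Mathlib.LinearAlgebra.Finsupp.LinearCombination
import Mathlib.Algebra.MvPolynomial.Monad
import Literature.Computability.MetaComplexity.PolynomialCalculusMultilinearCompleteness
import HarnessLib

/-!
# The residue of a polynomial modulo a Boolean solution set (Galesi–Lauria 2010, §2.1)

Galesi–Lauria (ACM ToCL 2010), following Alekhnovich–Razborov, prove polynomial-calculus degree
lower bounds with a linear operator built from RESIDUES: for a set `E` of polynomials (Boolean
axioms included) `R_E(q)` is "the minimal, with respect to `<_P`, polynomial `p` such that
`q - p ∈ Span(E)`" (§2.1; Property 1: `R_E(p) ≤_P p`, `p - q ∈ Span(E) ⇒ R_E(p) = R_E(q)`, `R_E`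
linear, `R_E(pq) = R_E(p · R_E(q))`).  With the Boolean axioms present, `Span(E)`-membership is
semantic (§2.2: "`g` has a PC proof from `E` iff `g = 0` on every common `0/1` root of `E`"), so the
residue is rendered SEMANTICALLY, relative to a set `A` of Boolean assignments (the common roots):
`bval x p` (value at a `0/1` point), `mkey s` (the COLEX key of a monomial's variable set — any
linear order of the variables; colex refines strict inclusion, which is all that is used),
`IsStd K A s` (standard monomial: on `A` not a combination of colex-smaller monomials),
`IsResidue` / `residue A p` (the unique multilinear polynomial on standard monomials agreeing with
`p` on `A`) with Property 1 (i)–(iii) (`residue_congr/_add/_smul/_sum`).  Property 1 (iv),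
`R_A(1) = 1`, the `<_P`-minimality and the behaviour under restrictions are in
`PolynomialCalculusResidueProperties.lean`; the closure/support machinery and the operator `L` of
GL10 §3 in `GraphOrderingPrincipleClosure.lean` / `GraphOrderingPrincipleDegreeProof.lean`.

Sources: N. Galesi, M. Lauria, *Optimality of size-degree tradeoffs for polynomial calculus*,
ACM ToCL 12(1) (2010), §2.1–2.2 [GalesiLauria2010] (held copy `paper:doi-10-1145-1838552-1838556`);
M. Alekhnovich, A. Razborov, *Lower bounds for polynomial calculus: non-binomial case* (2003),
context only.  Design: any field `K`, any assignment set `A` (for `A = ∅` the residue is `0`);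
multilinearity is `MLPC.mlMon s = s` on the support; existence of residues is a well-founded
induction on keys, whence the hypothesis `[WellFoundedLT (Colex (Finset σ))]` (true for finite
`σ` and for `σ = ℕ` by `Finset.Colex.orderIsoColex`).  Instance hint (referee W-A342-1): Mathlib has
no direct instance for the `Colex` wrapper; for finite `σ` obtain it from
`Finite.of_equiv (Finset σ) toColex` and `Finite.to_wellFoundedLT`; for `σ = ℕ` the users
(`GraphOrderingPrincipleDegreeProof.lean`, `PolynomialCalculusRespectfulExpanderDegree.lean`)
declare the local instance `wellFoundedLT_colex_nat` from `Finset.Colex.orderIsoColex`.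
-/

noncomputable section

namespace Literature.Computability.MetaComplexity

open Finset MvPolynomial

namespace PCResidue

variable {σ : Type*} {K : Type*} [Field K]

/-! ### Boolean values -/

/-- The value of `p` at the `0/1` point of the Boolean assignment `x`. [folklore] -/
def bval (x : σ → Bool) (p : MvPolynomial σ K) : K := eval (MLPC.boolPoint K x) p

/-- `bval` is additive. [folklore] -/
@[simp] theorem bval_add (x : σ → Bool) (p q : MvPolynomial σ K) :
    bval x (p + q) = bval x p + bval x q := map_add _ _ _

/-- `bval` is multiplicative. [folklore] -/
@[simp] theorem bval_mul (x : σ → Bool) (p q : MvPolynomial σ K) :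
    bval x (p * q) = bval x p * bval x q := map_mul _ _ _

/-- `bval` of a difference. [folklore] -/
@[simp] theorem bval_sub (x : σ → Bool) (p q : MvPolynomial σ K) :
    bval x (p - q) = bval x p - bval x q := map_sub _ _ _

/-- `bval` of a scalar multiple. [folklore] -/
@[simp] theorem bval_smul (x : σ → Bool) (a : K) (p : MvPolynomial σ K) :
    bval x (a • p) = a * bval x p := by
  rw [bval, smul_eval]; rfl

/-- `bval` of a sum. [folklore] -/
theorem bval_sum {ι : Type*} (x : σ → Bool) (s : Finset ι) (f : ι → MvPolynomial σ K) :
    bval x (∑ i ∈ s, f i) = ∑ i ∈ s, bval x (f i) := map_sum _ _ _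

/-- `bval 1 = 1`. [folklore] -/
@[simp] theorem bval_one (x : σ → Bool) : bval x (1 : MvPolynomial σ K) = 1 := map_one _

/-- `bval 0 = 0`. [folklore] -/
@[simp] theorem bval_zero (x : σ → Bool) : bval x (0 : MvPolynomial σ K) = 0 := map_zero _

/-- A monomial is `1` at a Boolean point iff all its variables are true there (exponents do not
matter). [folklore] -/
theorem bval_monomial (x : σ → Bool) (s : σ →₀ ℕ) (a : K) :
    bval x (monomial s a) = if ∀ i ∈ s.support, x i = true then a else 0 := by
  rw [bval, eval_monomial, Finsupp.prod]
  have : ∀ i ∈ s.support, MLPC.boolPoint K x i ^ s i = if x i = true then (1 : K) else 0 := by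
    intro i hi
    have hsi : s i ≠ 0 := Finsupp.mem_support_iff.1 hi
    unfold MLPC.boolPoint
    split_ifs with h
    · exact one_pow _
    · exact zero_pow hsi
  rw [Finset.prod_congr rfl this, Finset.prod_boole]
  split_ifs <;> simp

/-- The value of a monomial depends only on its set of variables. [folklore] -/
theorem bval_monomial_eq_of_support_eq (x : σ → Bool) {s t : σ →₀ ℕ} (h : s.support = t.support)
    (a : K) : bval x (monomial s a) = bval x (monomial t a) := by
  rw [bval_monomial, bval_monomial, h]

/-- `bval x p` as a sum over the monomials of `p`. [folklore] -/
theorem bval_eq_sum (x : σ → Bool) (p : MvPolynomial σ K) :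
    bval x p = ∑ s ∈ p.support, coeff s p * bval x (monomial s 1) := by
  conv_lhs => rw [p.as_sum, bval_sum]
  refine Finset.sum_congr rfl fun s _ => ?_
  rw [show monomial s (coeff s p) = coeff s p • monomial s (1 : K) by
    rw [smul_monomial, smul_eq_mul, mul_one], bval_smul]

/-! ### Keys of monomials and standard monomials -/

/-- The colex key of a monomial: its set of variables, in the colex order. [Galesi–Lauria 2010,
§2.1 (an admissible monomial order `<_P`)] [folklore] -/
def mkey (s : σ →₀ ℕ) : Colex (Finset σ) := toColex s.support

/-- Two multilinear exponent vectors with the same variables are equal. [folklore] -/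
theorem eq_of_mlMon_of_support_eq {s t : σ →₀ ℕ} (hs : MLPC.mlMon s = s) (ht : MLPC.mlMon t = t)
    (h : s.support = t.support) : s = t := by
  ext i
  rw [MLPC.mlMon_eq_self_iff] at hs ht
  by_cases hi : i ∈ s.support
  · have h1 : s i ≠ 0 := Finsupp.mem_support_iff.1 hi
    have h2 : t i ≠ 0 := Finsupp.mem_support_iff.1 (h ▸ hi)
    have := hs i; have := ht i; omega
  · have h1 : s i = 0 := Finsupp.notMem_support_iff.1 hi
    have h2 : t i = 0 := Finsupp.notMem_support_iff.1 (h ▸ hi)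
    rw [h1, h2]

/-- Multilinear exponent vectors with the same key are equal. [folklore] -/
theorem eq_of_mlMon_of_mkey_eq {s t : σ →₀ ℕ} (hs : MLPC.mlMon s = s) (ht : MLPC.mlMon t = t)
    (h : mkey s = mkey t) : s = t :=
  eq_of_mlMon_of_support_eq hs ht (toColex_inj.1 h)

variable (K) in
/-- The monomial `x^s` as a `K`-valued function on the assignment set `A`. [folklore] -/
def chi (A : Set (σ → Bool)) (s : σ →₀ ℕ) : A → K := fun x => bval x.1 (monomial s (1 : K))

variable (K) in
/-- A polynomial as a `K`-valued function on `A`. [folklore] -/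
def fnOn (A : Set (σ → Bool)) (p : MvPolynomial σ K) : A → K := fun x => bval x.1 p

/-- `fnOn A p` is the combination of the `chi A s` with the coefficients of `p`. [folklore] -/
theorem fnOn_eq_sum (A : Set (σ → Bool)) (p : MvPolynomial σ K) :
    fnOn K A p = ∑ s ∈ p.support, coeff s p • chi K A s := by
  funext x
  rw [fnOn, bval_eq_sum, Finset.sum_apply]
  rfl

/-- `chi` depends only on the set of variables. [folklore] -/
theorem chi_mlMon (A : Set (σ → Bool)) (s : σ →₀ ℕ) : chi K A (MLPC.mlMon s) = chi K A s := by
  funext x; exact bval_monomial_eq_of_support_eq _ (MLPC.support_mlMon s) _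

/-- `mkey` depends only on the set of variables. [folklore] -/
@[simp] theorem mkey_mlMon (s : σ →₀ ℕ) : mkey (MLPC.mlMon s) = mkey s := by
  rw [mkey, mkey, MLPC.support_mlMon]

variable [LinearOrder σ]

/-- The monomials colex-below `s`. [folklore] -/
def below (s : σ →₀ ℕ) : Set (σ →₀ ℕ) := {t | mkey t < mkey s}

variable (K) in
/-- `x^s` is a STANDARD monomial for the assignment set `A`: as a function on `A` it is not a
combination of colex-smaller monomials (equivalently, it is not the leading monomial of a
multilinear polynomial vanishing on `A`). [Galesi–Lauria 2010, §2.1 (residues w.r.t. `<_P`)]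
[folklore] -/
def IsStd (A : Set (σ → Bool)) (s : σ →₀ ℕ) : Prop :=
  chi K A s ∉ Submodule.span K (chi K A '' below s)

variable (K) in
/-- The multilinear standard monomials for `A`. [folklore] -/
def stdML (A : Set (σ → Bool)) : Set (σ →₀ ℕ) := {t | MLPC.mlMon t = t ∧ IsStd K A t}

/-- Standardness depends only on the set of variables. [folklore] -/
theorem isStd_mlMon_iff (A : Set (σ → Bool)) (s : σ →₀ ℕ) :
    IsStd K A (MLPC.mlMon s) ↔ IsStd K A s := by
  unfold IsStd below
  rw [chi_mlMon, mkey_mlMon]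

/-- Every monomial is, on `A`, a combination of multilinear standard monomials. [folklore] -/
theorem chi_mem_span_stdML [WellFoundedLT (Colex (Finset σ))] (A : Set (σ → Bool)) (s : σ →₀ ℕ) :
    chi K A s ∈ Submodule.span K (chi K A '' stdML K A) := by
  suffices h : ∀ m : Colex (Finset σ), ∀ s : σ →₀ ℕ, mkey s = m →
      chi K A s ∈ Submodule.span K (chi K A '' stdML K A) from h _ s rfl
  intro m
  induction m using WellFoundedLT.induction with
  | ind m ih =>
    intro s hs
    by_cases hstd : IsStd K A s
    · rw [← chi_mlMon]
      exact Submodule.subset_span ⟨MLPC.mlMon s, ⟨MLPC.mlMon_mlMon s, (isStd_mlMon_iff A s).2 hstd⟩,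
        rfl⟩
    · have hmem : chi K A s ∈ Submodule.span K (chi K A '' below s) := not_not.1 hstd
      refine (Submodule.span_le.2 ?_) hmem
      rintro _ ⟨t, ht, rfl⟩
      exact ih (mkey t) (hs ▸ ht) t rfl

/-- Hence every polynomial is, on `A`, such a combination. [folklore] -/
theorem fnOn_mem_span_stdML [WellFoundedLT (Colex (Finset σ))] (A : Set (σ → Bool))
    (p : MvPolynomial σ K) : fnOn K A p ∈ Submodule.span K (chi K A '' stdML K A) := by
  rw [fnOn_eq_sum]
  exact Submodule.sum_mem _ fun s _ => Submodule.smul_mem _ _ (chi_mem_span_stdML A s)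

/-! ### The residue -/

/-- `q` is a RESIDUE of `p` modulo (the vanishing ideal of) `A`: `q` is multilinear, supported on
standard monomials, and agrees with `p` on `A`. [Galesi–Lauria 2010, §2.1 (`R_E(q)`)]
[cite: GalesiLauria2010, §2.1] -/
structure IsResidue (A : Set (σ → Bool)) (p q : MvPolynomial σ K) : Prop where
  /-- `q` is multilinear -/
  mlMon_eq : ∀ s ∈ q.support, MLPC.mlMon s = s
  /-- `q` is supported on standard monomials -/
  isStd : ∀ s ∈ q.support, IsStd K A s
  /-- `q ≡ p` on `A` -/
  bval_eq : ∀ x ∈ A, bval x q = bval x p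

/-- Residues exist. [Galesi–Lauria 2010, §2.1 ("a minimum element in Span(E) always exists")]
[cite: GalesiLauria2010, §2.1] -/
theorem exists_isResidue [WellFoundedLT (Colex (Finset σ))] (A : Set (σ → Bool))
    (p : MvPolynomial σ K) : ∃ q, IsResidue A p q := by
  classical
  obtain ⟨l, hl, hcomb⟩ :=
    (Finsupp.mem_span_image_iff_linearCombination K).1 (fnOn_mem_span_stdML (K := K) A p)
  rw [Finsupp.mem_supported] at hl
  let q : MvPolynomial σ K := ∑ s ∈ l.support, monomial s (l s)
  have hcoeff : ∀ t, coeff t q = l t := by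
    intro t
    simp only [q, coeff_sum, coeff_monomial, Finset.sum_ite_eq', Finsupp.mem_support_iff, ne_eq,
      ite_not]
    split_ifs with h <;> simp [h]
  have hsupp : ∀ t ∈ q.support, t ∈ l.support := by
    intro t ht
    rw [mem_support_iff, hcoeff] at ht
    exact Finsupp.mem_support_iff.2 ht
  refine ⟨q, ⟨fun s hs => (hl (hsupp s hs)).1, fun s hs => (hl (hsupp s hs)).2, fun x hx => ?_⟩⟩
  have h1 : bval x q = ∑ s ∈ l.support, l s * bval x (monomial s 1) := by
    rw [bval_sum]
    refine Finset.sum_congr rfl fun s _ => ?_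
    rw [show monomial s (l s) = l s • monomial s (1 : K) by
      rw [smul_monomial, smul_eq_mul, mul_one], bval_smul]
  have h2 := congrFun hcomb ⟨x, hx⟩
  rw [Finsupp.linearCombination_apply, Finsupp.sum, Finset.sum_apply] at h2
  rw [h1]
  simpa [chi, fnOn] using h2

/-- A nonzero multilinear polynomial vanishing on `A` has a NON-standard colex-leading monomial.
[Galesi–Lauria 2010, §2.1] [folklore] -/
theorem not_isStd_of_vanish {A : Set (σ → Bool)} {d : MvPolynomial σ K}
    (hml : ∀ s ∈ d.support, MLPC.mlMon s = s) (hvan : ∀ x ∈ A, bval x d = 0) {s₀ : σ →₀ ℕ}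
    (hs₀ : s₀ ∈ d.support) (hmax : ∀ s ∈ d.support, mkey s ≤ mkey s₀) : ¬ IsStd K A s₀ := by
  classical
  intro hstd
  apply hstd
  have hsum : ∑ s ∈ d.support, coeff s d • chi K A s = 0 := by
    rw [← fnOn_eq_sum]; funext x; exact hvan x.1 x.2
  rw [← Finset.add_sum_erase _ _ hs₀] at hsum
  have hc : coeff s₀ d ≠ 0 := mem_support_iff.1 hs₀
  have h1 : coeff s₀ d • chi K A s₀ = -∑ s ∈ d.support.erase s₀, coeff s d • chi K A s :=
    eq_neg_of_add_eq_zero_left hsum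
  have hexpr : chi K A s₀ =
      (-(coeff s₀ d)⁻¹) • ∑ s ∈ d.support.erase s₀, coeff s d • chi K A s := by
    calc chi K A s₀ = (coeff s₀ d)⁻¹ • (coeff s₀ d • chi K A s₀) := by
          rw [smul_smul, inv_mul_cancel₀ hc, one_smul]
      _ = _ := by rw [h1, smul_neg, ← neg_smul]
  rw [hexpr]
  refine Submodule.smul_mem _ _ (Submodule.sum_mem _ fun s hs => Submodule.smul_mem _ _ ?_)
  refine Submodule.subset_span ⟨s, ?_, rfl⟩
  rw [Finset.mem_erase] at hs
  refine lt_of_le_of_ne (hmax s hs.2) fun h => hs.1 ?_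
  exact eq_of_mlMon_of_mkey_eq (hml s hs.2) (hml s₀ hs₀) h

/-- A multilinear polynomial supported on standard monomials and vanishing on `A` is zero.
[Galesi–Lauria 2010, §2.1] [folklore] -/
theorem eq_zero_of_isStd_of_vanish {A : Set (σ → Bool)} {d : MvPolynomial σ K}
    (hml : ∀ s ∈ d.support, MLPC.mlMon s = s) (hstd : ∀ s ∈ d.support, IsStd K A s)
    (hvan : ∀ x ∈ A, bval x d = 0) : d = 0 := by
  by_contra hne
  have hne' : d.support.Nonempty := by
    rw [Finset.nonempty_iff_ne_empty, ne_eq, support_eq_empty]; exact hne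
  obtain ⟨s₀, hs₀, hmax⟩ := Finset.exists_max_image d.support mkey hne'
  exact not_isStd_of_vanish hml hvan hs₀ hmax (hstd s₀ hs₀)

/-- Residues are unique. [Galesi–Lauria 2010, §2.1] [cite: GalesiLauria2010, §2.1] -/
theorem IsResidue.unique {A : Set (σ → Bool)} {p q q' : MvPolynomial σ K} (hq : IsResidue A p q)
    (hq' : IsResidue A p q') : q = q' := by
  rw [← sub_eq_zero]
  refine eq_zero_of_isStd_of_vanish (A := A) (fun s hs => ?_) (fun s hs => ?_) (fun x hx => ?_)
  · rcases Finset.mem_union.1 (support_sub σ q q' hs) with h | h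
    exacts [hq.mlMon_eq s h, hq'.mlMon_eq s h]
  · rcases Finset.mem_union.1 (support_sub σ q q' hs) with h | h
    exacts [hq.isStd s h, hq'.isStd s h]
  · rw [bval_sub, hq.bval_eq x hx, hq'.bval_eq x hx, sub_self]

section Residue

variable [WellFoundedLT (Colex (Finset σ))]

/-- **The residue `R_A(p)`**: the unique multilinear polynomial supported on standard monomials
that agrees with `p` on `A` (the `<_P`-minimal representative of `p` modulo the vanishing ideal
of `A`). [Galesi–Lauria 2010, §2.1 ("`R_E(q) = min{p : q - p ∈ Span(E)}`")]
[cite: GalesiLauria2010, §2.1] -/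
def residue (A : Set (σ → Bool)) (p : MvPolynomial σ K) : MvPolynomial σ K :=
  Classical.choose (exists_isResidue A p)

/-- `residue A p` is a residue of `p`. [Galesi–Lauria 2010, §2.1] [cite: GalesiLauria2010, §2.1] -/
theorem isResidue_residue (A : Set (σ → Bool)) (p : MvPolynomial σ K) :
    IsResidue A p (residue A p) :=
  Classical.choose_spec (exists_isResidue A p)

/-- Any residue is THE residue. [Galesi–Lauria 2010, §2.1] [cite: GalesiLauria2010, §2.1] -/
theorem IsResidue.eq_residue {A : Set (σ → Bool)} {p q : MvPolynomial σ K} (h : IsResidue A p q) :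
    q = residue A p :=
  h.unique (isResidue_residue A p)

/-- The residue is multilinear. [Galesi–Lauria 2010, §2.1] [cite: GalesiLauria2010, §2.1] -/
theorem mlMon_eq_of_mem_support_residue {A : Set (σ → Bool)} {p : MvPolynomial σ K} {s : σ →₀ ℕ}
    (hs : s ∈ (residue A p).support) : MLPC.mlMon s = s :=
  (isResidue_residue A p).mlMon_eq s hs

/-- The residue is supported on standard monomials. [Galesi–Lauria 2010, §2.1]
[cite: GalesiLauria2010, §2.1] -/
theorem isStd_of_mem_support_residue {A : Set (σ → Bool)} {p : MvPolynomial σ K} {s : σ →₀ ℕ}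
    (hs : s ∈ (residue A p).support) : IsStd K A s :=
  (isResidue_residue A p).isStd s hs

/-- The residue agrees with `p` on `A` (`E ⊢ p - R_E(p)`). [Galesi–Lauria 2010, §2.2]
[cite: GalesiLauria2010, §2.1] -/
theorem bval_residue {A : Set (σ → Bool)} (p : MvPolynomial σ K) {x : σ → Bool} (hx : x ∈ A) :
    bval x (residue A p) = bval x p :=
  (isResidue_residue A p).bval_eq x hx

/-- Property 1 (ii): polynomials that agree on `A` have the same residue. [Galesi–Lauria 2010,
§2.1 Property 1] [cite: GalesiLauria2010, §2.1 Property 1] -/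
theorem residue_congr {A : Set (σ → Bool)} {p p' : MvPolynomial σ K}
    (h : ∀ x ∈ A, bval x p = bval x p') : residue A p = residue A p' := by
  refine IsResidue.eq_residue ⟨fun s hs => mlMon_eq_of_mem_support_residue hs,
    fun s hs => isStd_of_mem_support_residue hs, fun x hx => ?_⟩
  rw [bval_residue p hx, h x hx]

/-- A polynomial vanishing on `A` has residue `0`. [Galesi–Lauria 2010, §2.1]
[cite: GalesiLauria2010, §2.1 Property 1] -/
theorem residue_eq_zero_of_vanish {A : Set (σ → Bool)} {p : MvPolynomial σ K}
    (h : ∀ x ∈ A, bval x p = 0) : residue A p = 0 :=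
  (IsResidue.eq_residue (A := A) (p := p) (q := 0) ⟨by simp, by simp, fun x hx => by
    rw [bval_zero, h x hx]⟩).symm

/-- Property 1 (iii): the residue is additive. [Galesi–Lauria 2010, §2.1 Property 1]
[cite: GalesiLauria2010, §2.1 Property 1] -/
theorem residue_add (A : Set (σ → Bool)) (p q : MvPolynomial σ K) :
    residue A (p + q) = residue A p + residue A q := by
  symm
  refine IsResidue.eq_residue ⟨fun s hs => ?_, fun s hs => ?_, fun x hx => ?_⟩
  · rcases Finset.mem_union.1 (support_add hs) with h | h
    exacts [mlMon_eq_of_mem_support_residue h, mlMon_eq_of_mem_support_residue h]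
  · rcases Finset.mem_union.1 (support_add hs) with h | h
    exacts [isStd_of_mem_support_residue h, isStd_of_mem_support_residue h]
  · rw [bval_add, bval_add, bval_residue p hx, bval_residue q hx]

/-- Property 1 (iii): the residue commutes with scalars. [Galesi–Lauria 2010, §2.1 Property 1]
[cite: GalesiLauria2010, §2.1 Property 1] -/
theorem residue_smul (A : Set (σ → Bool)) (a : K) (p : MvPolynomial σ K) :
    residue A (a • p) = a • residue A p := by
  symm
  refine IsResidue.eq_residue ⟨fun s hs => ?_, fun s hs => ?_, fun x hx => ?_⟩
  · exact mlMon_eq_of_mem_support_residue (support_smul hs)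
  · exact isStd_of_mem_support_residue (support_smul hs)
  · rw [bval_smul, bval_smul, bval_residue p hx]

variable (K) in
/-- The residue as a `K`-linear map. [Galesi–Lauria 2010, §2.1 Property 1 ("`R_E` is a linear
operator")] [cite: GalesiLauria2010, §2.1 Property 1] -/
def residueLin (A : Set (σ → Bool)) : MvPolynomial σ K →ₗ[K] MvPolynomial σ K where
  toFun := residue A
  map_add' := residue_add A
  map_smul' := residue_smul A

/-- `residueLin` is `residue`. [folklore] -/
@[simp] theorem residueLin_apply (A : Set (σ → Bool)) (p : MvPolynomial σ K) :
    residueLin K A p = residue A p := rfl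

/-- The residue of a finite sum. [Galesi–Lauria 2010, §2.1 Property 1]
[cite: GalesiLauria2010, §2.1 Property 1] -/
theorem residue_sum {ι : Type*} (A : Set (σ → Bool)) (s : Finset ι) (f : ι → MvPolynomial σ K) :
    residue A (∑ i ∈ s, f i) = ∑ i ∈ s, residue A (f i) := by
  rw [← residueLin_apply, map_sum]; rfl

end Residue

end PCResidue

end Literature.Computability.MetaComplexity
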